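import Summits.QuantumFields.YangMills.Theorems.FluctuationComparisonRegPrIntLS2BetaDistributedHolonomySU2
import HarnessLib

/-!
# SPREADING A BUNDLE OF FACE DATA OVER PARALLEL LINES: the explicit root chains, their longitudinal `ℓ²` cost `(π²∕4)∕n`, and the transversal cost NOT INCREASED inside the `dist1 ≤ √2` ball
# (crux `FluctuationComparisonRegPrIntL`, stmt-QuantumFields-20520; registry v11.4 `Cruxes/FluctuationComparisonRegPrIntL/Lines/semiclassical_s2beta.lean` 3732b7df FROZEN, untouched)

Cell `ym3-torus` (YM ladder rung R3 = continuum `SU(2)` Yang–Mills on the three-torus — a RUNG: NOT d = 4, NOT infinite volume, NOT a mass gap, NOT Clay).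
Width seat `ym3-torus-px12` (gen 22); `--kind proof --supports stmt-QuantumFields-20520 --as helper`, count-neutral, DEFINITION-FREE (0 `def`, 0 `instance`,
0 `notation`, 0 `sorry`, default heartbeats).  Consumable `∃`-free edition of ✓(8) `…S2BetaDistributedHolonomySU2` for a finite bundle of lines.

WHY.  A distributed-holonomy gauge (px20 g18 UV3-NODE §53 (53.5); HOME note `ym3-torus-px12/g22/HFLAT-ROAD-AFTER-6.px12g22.md` §3 (L)(T)) replaces, on every line `x` of a face bundle `Φ`,
the jump `X_x ∈ SU(2)` by the EXPLICIT chain `c_{X}(s) = exp(((n−s)∕n)·ι log X)` (`s = 0, …, n`).  This file records what that costs: longitudinally `(π²∕4)·Σ_x dist1(X_x)²∕n` (✓(8)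
root chains), transversally — for every pair of lines and every layer `s` — NOT MORE than the data's own `dist1(X_x X_{x′}⁻¹)`, provided all data lie in the ball `dist1 ≤ √2` (= `‖log‖ ≤ π∕2`, the
closed hemisphere; ✓(8) `dist1_expPoint_smul_mul_inv_le`).  Outside that ball (near the cut locus `−1`) the transversal statement is false — the located residue (α) of the ledger.

WHAT.  §1 `norm_logVec_le_pi_div_two_of_dist1_le_sqrt_two` (`dist1 X ≤ √2 ⟹ ‖log X‖ ≤ π∕2`).  §2 the explicit chain `s ↦ expPoint(((n−s)∕n)•logVec(su2Quat X))`: `chain_zero`, `chain_of_le`,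
`chain_succ_step` (every step is the root), `dist1_chain_step_le`, ★`sum_sq_chain_step_le` (`≤ (π²∕4)·dist1(X)²∕n`), ★★`dist1_chain_mul_inv_chain_le` (layer `s`: `≤ dist1(X Y⁻¹)` in the ball).
§3 bundles: ★★`sum_sum_sq_chain_step_le` (longitudinal, over a Finset of lines), ★★`sum_sum_sq_chain_transversal_le` (over a Finset of pairs and the `n+1` layers: `≤ (n+1)·Σ_pairs dist1(X_x X_{x′}⁻¹)²`).

HONEST: group geometry + sums; the transversal bound is the NAIVE layer count `(n+1)·Σ_pairs` (the ledger's on-target treatment goes through the pair VARIANCE ✓(7), not typed here); no lattice, no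
field, no gauge construction; nothing of Bałaban's analysis; hFlat, TUBE-REG∘, GAP♯∘, EXW∘, S2β, crux 20520 NOT proved; no registered stub is closed; rung R3 = SU(2) YM₃ on T³ — NOT d = 4, NOT
infinite volume, NOT a mass gap, NOT Clay; the Yang–Mills mass gap is NOT proved.  Sorry-free, axioms standard.

References: T. Bałaban, CMP **99** (1985) 75–102 [Balaban1985RegularSpaces] ((1.29) p.81, (1.36) p.82, Thm 2 p.83); CMP **96** (1984) 223–250 [Balaban1984PropagatorsII] ((1.33)).
-/

set_option autoImplicit false

noncomputable section

namespace Summit.QuantumFields.YangMills.Theorems.FluctuationComparisonRegPrIntLS2BetaLineBundleSpreading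

open NormedSpace
open scoped Real Quaternion RealInnerProductSpace
open Literature.MathematicalPhysics.QuantumLattice (su2Quat norm_su2Quat)
open Literature.MathematicalPhysics.QuantumFieldTheory.Balaban1983to89
open T4CubeChartGnomonic (SU2)
open T4HaarSU2ExpChart (expPoint expPoint_zero)
open T4ExpWindowSmallField (logVec norm_logVec norm_logVec_le_pi expPoint_logVec dist1_expPoint_le dist1_eq_two_mul_sin)
open Summit.QuantumFields.YangMills.Theorems.FluctuationComparisonRegPrIntLS2BetaDistributedHolonomySU2
  (expPoint_add_smul norm_logVec_le_pi_div_two_mul_dist1 dist1_expPoint_smul_mul_inv_le)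

/-! ## §1 The ball `dist1 ≤ √2` is the closed hemisphere `‖log‖ ≤ π∕2` -/

/-- `dist1 X ≤ √2 ⟹ ‖log X‖ ≤ π∕2` (`dist1 X = 2 sin(‖log X‖∕2)`, `√2 = 2 sin(π∕4)`, `sin` increasing on `[0, π∕2]`). [folklore] -/
theorem norm_logVec_le_pi_div_two_of_dist1_le_sqrt_two {X : SU2} (hX : dist1 X ≤ Real.sqrt 2) : ‖logVec (su2Quat X)‖ ≤ π / 2 := by
  have hπ := Real.pi_pos
  have hθ0 : 0 ≤ ‖logVec (su2Quat X)‖ := norm_nonneg _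
  have hθπ := norm_logVec_le_pi (su2Quat X)
  rw [dist1_eq_two_mul_sin] at hX
  have hs : Real.sin (‖logVec (su2Quat X)‖ / 2) ≤ Real.sin (π / 4) := by
    rw [Real.sin_pi_div_four]
    linarith
  by_contra hlt
  rw [not_le] at hlt
  have hlt' : π / 4 < ‖logVec (su2Quat X)‖ / 2 := by linarith
  have := Real.sin_lt_sin_of_lt_of_le_pi_div_two (by linarith) (by linarith) hlt'
  linarith

/-! ## §2 The explicit chain of one datum -/

variable (X : SU2) (n : ℕ)

/-- The chain starts at the datum: `c_X(0) = X`. [cite: Balaban1985RegularSpaces, (1.29) p.81] -/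
theorem chain_zero (hn : 0 < n) : expPoint ((((n - 0 : ℕ) : ℝ) / n) • logVec (su2Quat X)) = X := by
  have hn' : (n : ℝ) ≠ 0 := by exact_mod_cast hn.ne'
  rw [Nat.sub_zero, div_self hn', one_smul, expPoint_logVec]

/-- The chain has arrived by layer `n`: `c_X(s) = 1` for `s ≥ n`. [cite: Balaban1985RegularSpaces, (1.29) p.81] -/
theorem chain_of_le {s : ℕ} (hs : n ≤ s) : expPoint ((((n - s : ℕ) : ℝ) / n) • logVec (su2Quat X)) = 1 := by
  rw [Nat.sub_eq_zero_of_le hs, Nat.cast_zero, zero_div, zero_smul, expPoint_zero]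

/-- Every step of the chain is the `n`-th root: `c_X(s)·c_X(s+1)⁻¹ = exp(ι log X ∕ n)` (`s < n`). [cite: Balaban1985RegularSpaces, (1.29) p.81] -/
theorem chain_succ_step {s : ℕ} (hs : s < n) :
    expPoint ((((n - s : ℕ) : ℝ) / n) • logVec (su2Quat X)) * (expPoint ((((n - (s + 1) : ℕ) : ℝ) / n) • logVec (su2Quat X)))⁻¹ =
      expPoint (((1 : ℝ) / n) • logVec (su2Quat X)) := by
  have hn' : (n : ℝ) ≠ 0 := by exact_mod_cast (Nat.lt_of_le_of_lt (Nat.zero_le s) hs).ne'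
  have e : (((n - s : ℕ) : ℝ) / n) = 1 / n + (((n - (s + 1) : ℕ) : ℝ) / n) := by
    rw [Nat.cast_sub hs.le, Nat.cast_sub (Nat.succ_le_of_lt hs), Nat.cast_succ]
    field_simp
    ring
  rw [e, expPoint_add_smul, mul_inv_cancel_right]

/-- The step is small: `dist1(c_X(s)·c_X(s+1)⁻¹) ≤ (π∕2)·dist1(X)∕n` (`s < n`). [cite: Balaban1985RegularSpaces, (1.29) p.81] -/
theorem dist1_chain_step_le {s : ℕ} (hs : s < n) :
    dist1 (expPoint ((((n - s : ℕ) : ℝ) / n) • logVec (su2Quat X)) * (expPoint ((((n - (s + 1) : ℕ) : ℝ) / n) • logVec (su2Quat X)))⁻¹) ≤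
      π / 2 * dist1 X / n := by
  have hn : 0 < n := Nat.lt_of_le_of_lt (Nat.zero_le s) hs
  have hn0 : (0 : ℝ) < n := by exact_mod_cast hn
  rw [chain_succ_step X n hs]
  refine (dist1_expPoint_le _).trans ?_
  rw [norm_smul, norm_div, norm_one, Real.norm_eq_abs, abs_of_pos hn0, one_div, inv_mul_eq_div, div_le_div_iff_of_pos_right hn0]
  exact norm_logVec_le_pi_div_two_mul_dist1 X

/-- ★ **The longitudinal `ℓ²` cost of one chain**: `Σ_{s<n} dist1(c_X(s)·c_X(s+1)⁻¹)² ≤ (π²∕4)·dist1(X)²∕n`. [cite: Balaban1985RegularSpaces, (1.29) p.81, (1.36) p.82] -/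
theorem sum_sq_chain_step_le (hn : 0 < n) :
    ∑ s ∈ Finset.range n, dist1 (expPoint ((((n - s : ℕ) : ℝ) / n) • logVec (su2Quat X)) *
        (expPoint ((((n - (s + 1) : ℕ) : ℝ) / n) • logVec (su2Quat X)))⁻¹) ^ 2 ≤ π ^ 2 / 4 * dist1 X ^ 2 / n := by
  have hn0 : (0 : ℝ) < n := by exact_mod_cast hn
  calc _ ≤ ∑ _s ∈ Finset.range n, (π / 2 * dist1 X / n) ^ 2 :=
        Finset.sum_le_sum fun s hs => pow_le_pow_left₀ (GaugeGroup.dist1_nonneg _) (dist1_chain_step_le X n (Finset.mem_range.1 hs)) 2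
    _ = π ^ 2 / 4 * dist1 X ^ 2 / n := by rw [Finset.sum_const, Finset.card_range, nsmul_eq_mul]; field_simp; ring

/-- ★★ **Two chains with nearby data stay nearby, layer by layer, inside the ball `dist1 ≤ √2`**: `dist1(c_X(s)·c_Y(s)⁻¹) ≤ dist1(X·Y⁻¹)` for every `s`.
[cite: Balaban1985RegularSpaces, (1.36) p.82] -/
theorem dist1_chain_mul_inv_chain_le (Y : SU2) (hX : dist1 X ≤ Real.sqrt 2) (hY : dist1 Y ≤ Real.sqrt 2) (s : ℕ) :
    dist1 (expPoint ((((n - s : ℕ) : ℝ) / n) • logVec (su2Quat X)) * (expPoint ((((n - s : ℕ) : ℝ) / n) • logVec (su2Quat Y)))⁻¹) ≤ dist1 (X * Y⁻¹) := by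
  rcases Nat.eq_zero_or_pos n with hn | hn
  · subst hn
    rw [Nat.zero_sub, Nat.cast_zero, zero_div, zero_smul, zero_smul, expPoint_zero, inv_one, mul_one, GaugeGroup.dist1_one]
    exact GaugeGroup.dist1_nonneg _
  have hn0 : (0 : ℝ) < n := by exact_mod_cast hn
  have ht0 : (0 : ℝ) ≤ ((n - s : ℕ) : ℝ) / n := by positivity
  have ht1 : ((n - s : ℕ) : ℝ) / n ≤ 1 := by rw [div_le_one hn0]; exact_mod_cast Nat.sub_le n s
  have h := dist1_expPoint_smul_mul_inv_le (logVec (su2Quat X)) (logVec (su2Quat Y)) (norm_logVec_le_pi_div_two_of_dist1_le_sqrt_two hX)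
    (norm_logVec_le_pi_div_two_of_dist1_le_sqrt_two hY) ht0 ht1
  rwa [expPoint_logVec, expPoint_logVec] at h

/-! ## §3 A finite bundle of lines -/

/-- ★★ **THE LONGITUDINAL COST OF A BUNDLE**: over a finite set `Φ` of lines with data `X : Φ → SU(2)`, `Σ_{x∈Φ} Σ_{s<n} dist1(step)² ≤ (π²∕4)∕n · Σ_{x∈Φ} dist1(X_x)²`.
[cite: Balaban1985RegularSpaces, (1.29) p.81, (1.36) p.82] -/
theorem sum_sum_sq_chain_step_le {ι : Type*} (Φ : Finset ι) (Xd : ι → SU2) (hn : 0 < n) :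
    ∑ x ∈ Φ, ∑ s ∈ Finset.range n, dist1 (expPoint ((((n - s : ℕ) : ℝ) / n) • logVec (su2Quat (Xd x))) *
        (expPoint ((((n - (s + 1) : ℕ) : ℝ) / n) • logVec (su2Quat (Xd x))))⁻¹) ^ 2 ≤ π ^ 2 / 4 / n * ∑ x ∈ Φ, dist1 (Xd x) ^ 2 := by
  rw [Finset.mul_sum]
  refine Finset.sum_le_sum fun x _ => (sum_sq_chain_step_le (Xd x) n hn).trans (le_of_eq ?_)
  ring

/-- ★★ **THE TRANSVERSAL COST OF A BUNDLE, NAIVE LAYER COUNT**: over a finite set `E` of pairs of lines whose data all lie in the ball `dist1 ≤ √2`,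
`Σ_{(x,x′)∈E} Σ_{s≤n} dist1(c_{X_x}(s)·c_{X_{x′}}(s)⁻¹)² ≤ (n+1)·Σ_{(x,x′)∈E} dist1(X_x·X_{x′}⁻¹)²`. [cite: Balaban1985RegularSpaces, (1.36) p.82] -/
theorem sum_sum_sq_chain_transversal_le {ι : Type*} (E : Finset (ι × ι)) (Xd : ι → SU2) (hXd : ∀ x, dist1 (Xd x) ≤ Real.sqrt 2) :
    ∑ e ∈ E, ∑ s ∈ Finset.range (n + 1), dist1 (expPoint ((((n - s : ℕ) : ℝ) / n) • logVec (su2Quat (Xd e.1))) *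
        (expPoint ((((n - s : ℕ) : ℝ) / n) • logVec (su2Quat (Xd e.2))))⁻¹) ^ 2 ≤ ((n + 1 : ℕ) : ℝ) * ∑ e ∈ E, dist1 (Xd e.1 * (Xd e.2)⁻¹) ^ 2 := by
  rw [Finset.mul_sum]
  refine Finset.sum_le_sum fun e _ => ?_
  calc _ ≤ ∑ _s ∈ Finset.range (n + 1), dist1 (Xd e.1 * (Xd e.2)⁻¹) ^ 2 :=
        Finset.sum_le_sum fun s _ => pow_le_pow_left₀ (GaugeGroup.dist1_nonneg _)
          (dist1_chain_mul_inv_chain_le (Xd e.1) n (Xd e.2) (hXd e.1) (hXd e.2) s) 2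
    _ = ((n + 1 : ℕ) : ℝ) * dist1 (Xd e.1 * (Xd e.2)⁻¹) ^ 2 := by rw [Finset.sum_const, Finset.card_range, nsmul_eq_mul]

end Summit.QuantumFields.YangMills.Theorems.FluctuationComparisonRegPrIntLS2BetaLineBundleSpreading

end
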